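import Literature.MathematicalPhysics.QuantumFieldTheory.Balaban1983to89.Node00.N24ItemsStage13AtThm1CCMWOfStepRSignFreeAllTorusSepCoPH
import Summits.QuantumFields.YangMills.Theorems.BalabanUVNodesN09AxialCovariance181OnDomainsReg8Nesting
import Summits.QuantumFields.YangMills.Theorems.BalabanUVNodesN09AtSmallFieldBookkeeping
import Summits.QuantumFields.YangMills.Theorems.BalabanUVNodesN09TwoRadiiDoorForall

/-!
# NODE N24 (B2) — N09's THEOREM-3 TYPE `h09T` OF THE SPLIT CLOSERS (Parts 23∕24) SUPPLIED BY NAME FROM N09's TWO LOCATED DOORS OF RECORD AT THE WITNESS: dag-n09-w2's AXIAL on-domains door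
# v1.2 (p601129) and dag-n09-w3's COVARIANT small-field-bookkeeping door (p598357) — so the `h09T` slot of `…N24K1OfStubsV19ChildrenSplit(RunRows)WorldBuilt` reads, by name, exactly N09's
# located list (general `N`, door letters fixed; threshold `γ₉ := 1`, unread)

TRACK A (YM-PLAN §2d, node N24 of 28 = binder B2), seat `pub-ymgap-dag-n24-c` (R134 fan-out seat, strategy s2; gen 9, Part 25).  Key of record: K1⁷ `StabilityBAtRecordR13SepCoPH` =
stmt-QuantumFields-20542; this file `--supports` it as a helper (Summits lane).
WHY.  Parts 23∕24 (p602318 ∕ 30H) key every child of the K1⁷ closing form on ONE world-free TYPE; N09's Theorem-3 member is `h09T : ∃ γ₉ > 0, ∀ w : WorldP, w.C = datum.C → w.γ ≤ γ₉ →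
∀ P, (leavesP w P).smallCouplings → (leavesP w P).smallFieldInductive` at the door's datum over the witness `θ₁₅ᶜᶜᴹᵂ(j; γ; …)`.  N09's lanes deliver that implication AT EVERY BOUND WORLD
(`{w} (hC : w.C = …)`, no window read — so `γ₉ := 1`) modulo LOCATED lists; this file instantiates their two doors of record at the witness, so a K1 closer writes `h09T :=` §1 or §2 with the
located binders displayed in N09's own words (Parts 20–22 did this for Part 14's un-split door forms; these are the split-type twins):
* §1 `N24_h09T_theta13OfThm1CCMW_of_n09OnDomainsReg8SuppPt` ← dag-n09-w2 g2 `N09AxialCovariance181OnDomainsReg8Nesting.thm3Member_forall_stage13SepCoPH_onDomains_of_axialOn_of_reg8_of_suppPt`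
  (THE AXIAL ROAD v1.2: `hreg8` minimiser at `εbg` in the regular class at `εreg` ([15] (6)∕(8)), `hle9 : εreg ≤ εbg` (= `a₀ ≤ 1` at this witness; free on the K0 side by
  `Prop8RegSepTopStep.of_le`), `hεreg : 0 ≤ εreg`, `haxDom` [I] (2.3)'s axial convention of the record's critical configuration (satisfiable by re-selection, dag-n09-w2 FILE 8; adoption =
  a record edition), `haxbg` the background minimisers' averages axial (dag-n09-w3's hierarchical selection supplies it by construction), pointwise (F7a) `hχregpt`, (I19) `hint9`, [B11]
  Thm 1 ×3 at `εbg` (`h07sol h07res h07uniq` — N07's content), `hε9 : 0 < ε₂₉`, `hεbg : 0 < εbg` and three [B7]-numerics per run — NO covariance, NO χ-invariance, NO nesting);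
* §2 `N24_h09T_theta13OfThm1CCMW_of_n09AtDomAltOrbitRel` ← dag-n09-w3 g2 `N09AtSmallFieldBookkeeping.thm3Member_forall_stage13SepCoPH_atDomAlt_of_orbitRel` (THE COVARIANT ROAD: (181)
  covariance `hcov` ON THE SOLVABLE CONFIGURATIONS at `εreg` (the located, non-vacuous form — the global form is refuted at the junk corner, dag-n09-w2 p583470), `hsolν`, support clause
  `hχdom`, (I19) `hint9`, regularity inclusion `hreg`, [B11] ×3 at `εbg`, the one-orbit clause `horb`, `hε9 : 0 < ε₂₉`).
At the witness the record's fields read `θ₁₅ᶜᶜᴹᵂ.ν`, `.εbg`, `.ε₂₉` (`rfl` through `ofHistoryBlind`).  A NEW importing module (imports Part 14 + the two N09 doors).  THEOREMS ONLY, def-free,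
sorry-free, standard axioms; each proof is ONE application of the N09 door.

HONEST FRAMING: composition BY NAME; nothing of Bałaban's asserted — every N09 binder is DISPLAYED exactly as its lane located it; N09 NOT discharged; K0⁷ ∕ K1⁷ NOT closed; N24 COMPOSITE —
no discharge, no count moved (5∕27 · A 5∕28); one finite 𝕋⁴ programme at fixed ε; R4 = the conditional finite-𝕋⁴ rung `BalabanLadder.UV` only — NOT continuum ∕ ℝ⁴ ∕ OS ∕ mass gap ∕ Clay.
-/

noncomputable section

open MeasureTheory
open scoped Matrix.Norms.L2Operator

namespace Summit.QuantumFields.YangMills.BalabanUVNodes.N24ChildrenSplitN09Suppliers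

open Literature.MathematicalPhysics.QuantumFieldTheory.Balaban1983to89
open Literature.MathematicalPhysics.QuantumFieldTheory.Balaban1983to89.Node00
open DagBinding T4Continuum T4DatumAssembly FlowStepRuns AveragingRT
open FlowStep (BetaLowerH BetaUpperH)
open B12RTGaugeInvariance254 (liftTransf)
open B12GaugeOrbits021 (OrbitRel)
open GaugeField (gaugeAct)
open ExpMeanLog (deltaSU)
open Summit.QuantumFields.YangMills.BalabanUVNodes.N09AxialCovariance181OnDomainsReg8Nesting (thm3Member_forall_stage13SepCoPH_onDomains_of_axialOn_of_reg8_of_suppPt)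
open Summit.QuantumFields.YangMills.BalabanUVNodes.N09AtSmallFieldBookkeeping (thm3Member_forall_stage13SepCoPH_atDomAlt_of_orbitRel)

variable {F : T4Family} {N : ℕ} [NeZero N]

/-- **★ N09's TYPE `h09T` OF THE SPLIT CLOSERS AT THE WITNESS, SUPPLIED BY dag-n09-w2's AXIAL ON-DOMAINS DOOR v1.2** (`…OnDomainsReg8Nesting.thm3Member_forall_stage13SepCoPH_onDomains_of_axialOn_of_reg8_of_suppPt`,
p601129, ONE application at `(θ₁₅ᶜᶜᴹᵂ-door, w, hC)`; threshold `γ₉ := 1`, unread).  Displayed = N09's located list VERBATIM at the witness: contour systems `cd`, `hreg8`, `hle9`, `hεreg`,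
`haxDom`, `haxbg`, `hχregpt`, `hint9`, [B11] ×3 `h07sol h07res h07uniq`, `hε9`, `hεbg`, `hε3 hε2 hε₀`.  CONDITIONAL; N09 NOT discharged; K1⁷ NOT closed. [cite: Balaban1987RG1, Thm 3 p.264, p.259, (0.19) p.255, (1.1)–(1.3) p.260, (2.1)–(2.3) p.265, (2.9)–(2.10) pp.266–267, Lemma 4 p.280; Balaban1985Variational, Thm 1 (6), (8)–(10) p.279 and (181) p.307; Balaban1985Averaging, Prop. 2 (53)–(54) p.26; Balaban1989LargeFieldII, Thm 1 p.355 (bookkeeping)] -/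
theorem N24_h09T_theta13OfThm1CCMW_of_n09OnDomainsReg8SuppPt {j c : ℕ} {γ ε₀ ε₂₉ B₃ B₃' a₀ a₁ : ℝ} (hγ₀ : 0 < γ) (hγh : γ ≤ 1 / 2)
    (hε : 0 < ε₀) (hε' : 0 < ε₂₉) (hB : 0 ≤ B₃) (hB' : 0 ≤ B₃') (ha₀ : 0 < a₀) (ha₁ : 0 < a₁)
    (h15 : VariationalThm1RegSepCoP7M F N B₃ a₀ a₁) (hc : c ≤ F.L ^ j)
    (h9 : Gauge9RegSepTopStepR F N (fun ν K Ω => suppDomOfRecord F ν K Ω) (F.L ^ j) c B₃ B₃' a₀ a₁)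
    {bl β' : ℝ} (hbox : BetaLowerH bl γ (betaOfRecord₁₃ F N (theta13OfThm1CCMW F N j γ ε₀ ε₂₉ B₃ B₃' a₀ a₁)))
    (hbox' : BetaUpperH β' γ (betaOfRecord₁₃ F N (theta13OfThm1CCMW F N j γ ε₀ ε₂₉ B₃ B₃' a₀ a₁))) (hl : -bl * γ ^ 2 ≤ 3) (hβ' : β' * γ ^ 2 ≤ 3 / 4)
    (cd : (P : B12.RunParams) → (j : ℕ) → ContourData (F.P P.K) j (SU N))
    (hreg8 : ∀ (P : B12.RunParams) (k : ℕ), k ≤ P.K → ∀ V ∈ domAltOfRecord F N (theta13OfThm1CCMW F N j γ ε₀ ε₂₉ B₃ B₃' a₀ a₁).ν P.K k, Uk F N P.K k (theta13OfThm1CCMW F N j γ ε₀ ε₂₉ B₃ B₃' a₀ a₁).εbg V ∈ bgReg F N P.K k (theta13OfThm1CCMW F N j γ ε₀ ε₂₉ B₃ B₃' a₀ a₁).ν.εreg)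
    (hle9 : (theta13OfThm1CCMW F N j γ ε₀ ε₂₉ B₃ B₃' a₀ a₁).ν.εreg ≤ (theta13OfThm1CCMW F N j γ ε₀ ε₂₉ B₃ B₃' a₀ a₁).εbg)
    (hεreg : 0 ≤ (theta13OfThm1CCMW F N j γ ε₀ ε₂₉ B₃ B₃' a₀ a₁).ν.εreg)
    (haxDom : ∀ (P : B12.RunParams), ∀ j < P.K, ∀ W ∈ domAltOfRecord F N (theta13OfThm1CCMW F N j γ ε₀ ε₂₉ B₃ B₃' a₀ a₁).ν P.K (j + 1), AxialGauge (cd P j) (critCfgOfRecord F N (theta13OfThm1CCMW F N j γ ε₀ ε₂₉ B₃ B₃' a₀ a₁).ν P.K j W))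
    (haxbg : ∀ (P : B12.RunParams) (k : ℕ), k ≤ P.K → ∀ V ∈ domAltOfRecord F N (theta13OfThm1CCMW F N j γ ε₀ ε₂₉ B₃ B₃' a₀ a₁).ν P.K k, ∀ j < k,
      AxialGauge (cd P j) (Averaging.iter (avOfRecord F N P.K) j (Uk F N P.K k (theta13OfThm1CCMW F N j γ ε₀ ε₂₉ B₃ B₃' a₀ a₁).εbg V)))
    (hχregpt : ∀ (P : B12.RunParams) (i : ℕ), i + 1 < P.K → ∀ U : GaugeField (F.P P.K) (i + 1) (SU N),
      (avOfRecord F N P.K (i + 1)).avg U ∈ domAltOfRecord F N (theta13OfThm1CCMW F N j γ ε₀ ε₂₉ B₃ B₃' a₀ a₁).ν P.K (i + 2) →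
        U ∉ regSetOfRecord F N P.K i (betaInputOfRecord F N (TβOfRecord₁₃ F N) (chiβOfRecord₁₃ F N (theta13OfThm1CCMW F N j γ ε₀ ε₂₉ B₃ B₃' a₀ a₁)) P.K (gOfRecord₁₃ F N (theta13OfThm1CCMW F N j γ ε₀ ε₂₉ B₃ B₃' a₀ a₁) P) i) ∩
            domAltOfRecord F N (theta13OfThm1CCMW F N j γ ε₀ ε₂₉ B₃ B₃' a₀ a₁).ν P.K (i + 1) →
          chiβOfRecord₁₃ F N (theta13OfThm1CCMW F N j γ ε₀ ε₂₉ B₃ B₃' a₀ a₁) P.K (gOfRecord₁₃ F N (theta13OfThm1CCMW F N j γ ε₀ ε₂₉ B₃ B₃' a₀ a₁) P) (i + 1) U = 0)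
    (hint9 : ∀ (P : B12.RunParams), ∀ j < P.K, Integrable (betaInputOfRecord F N (TβOfRecord₁₃ F N) (chiβOfRecord₁₃ F N (theta13OfThm1CCMW F N j γ ε₀ ε₂₉ B₃ B₃' a₀ a₁)) P.K
      (gOfRecord₁₃ F N (theta13OfThm1CCMW F N j γ ε₀ ε₂₉ B₃ B₃' a₀ a₁) P) j) (fieldMeasure (F.P P.K) j (SU N)))
    (h07sol : ∀ (P : B12.RunParams) (k : ℕ), k ≤ P.K → ∀ V ∈ domAltOfRecord F N (theta13OfThm1CCMW F N j γ ε₀ ε₂₉ B₃ B₃' a₀ a₁).ν P.K k, UkExists F N P.K k (theta13OfThm1CCMW F N j γ ε₀ ε₂₉ B₃ B₃' a₀ a₁).εbg V ∧ UniqueUkOrbit F N P.K k (theta13OfThm1CCMW F N j γ ε₀ ε₂₉ B₃ B₃' a₀ a₁).εbg V)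
    (h07res : ∀ (P : B12.RunParams) (k : ℕ), k ≤ P.K → HRestrict F N (theta13OfThm1CCMW F N j γ ε₀ ε₂₉ B₃ B₃' a₀ a₁).εbg P.K k (domAltOfRecord F N (theta13OfThm1CCMW F N j γ ε₀ ε₂₉ B₃ B₃' a₀ a₁).ν P.K k))
    (h07uniq : ∀ (P : B12.RunParams) (k : ℕ), k ≤ P.K → ∀ V ∈ domAltOfRecord F N (theta13OfThm1CCMW F N j γ ε₀ ε₂₉ B₃ B₃' a₀ a₁).ν P.K k, ∀ j < k,
      UniqueUkOrbit F N P.K (j + 1) (theta13OfThm1CCMW F N j γ ε₀ ε₂₉ B₃ B₃' a₀ a₁).εbg (Averaging.iter (avOfRecord F N P.K) (j + 1) (Uk F N P.K k (theta13OfThm1CCMW F N j γ ε₀ ε₂₉ B₃ B₃' a₀ a₁).εbg V)))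
    (hε9 : 0 < (theta13OfThm1CCMW F N j γ ε₀ ε₂₉ B₃ B₃' a₀ a₁).ε₂₉)
    (hεbg : 0 < (theta13OfThm1CCMW F N j γ ε₀ ε₂₉ B₃ B₃' a₀ a₁).εbg)
    (hε3 : ∀ P : B12.RunParams, (143 * (((((F.P P.K).d + 4 : ℕ) : ℝ)) ^ 2 / 4) ^ 2) * (theta13OfThm1CCMW F N j γ ε₀ ε₂₉ B₃ B₃' a₀ a₁).εbg ≤ 1 / 3)
    (hε2 : ∀ P : B12.RunParams, 2 * (theta13OfThm1CCMW F N j γ ε₀ ε₂₉ B₃ B₃' a₀ a₁).εbg ≤ 2 * deltaSU (Fin N) / ((((F.P P.K).d + 4) * (F.P P.K).L : ℕ) : ℝ) ^ 2)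
    (hε₀ : ∀ P : B12.RunParams, 2 * (theta13OfThm1CCMW F N j γ ε₀ ε₂₉ B₃ B₃' a₀ a₁).εbg ≤ (theta13OfThm1CCMW F N j γ ε₀ ε₂₉ B₃ B₃' a₀ a₁).ν.ε₀ * ((F.P P.K).L : ℝ) ^ 2) :
    ∃ γ₉ : ℝ, 0 < γ₉ ∧ ∀ w : WorldP, w.C = (datumOfRecord₁₃SepCoPH F N (Stage13HParams.ofHistoryBlind F N ⟨theta13OfThm1CCMW F N j γ ε₀ ε₂₉ B₃ B₃' a₀ a₁, ZrOfRecord₁₃ F N (theta13OfThm1CCMW F N j γ ε₀ ε₂₉ B₃ B₃' a₀ a₁)⟩) (N24_provisos₁₃SepCoPH_door_theta13OfThm1CCMW_of_gauge9TopStepR_of_betaBoxSignFree_allTorus hγ₀ hγh hε hε' hB hB' ha₀ ha₁ h15 hc h9 hbox hbox' hl hβ')).C →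
      w.γ ≤ γ₉ → ∀ P : B12.RunParams, (leavesP w P).smallCouplings → (leavesP w P).smallFieldInductive :=
  ⟨1, one_pos, fun _ hC _ => thm3Member_forall_stage13SepCoPH_onDomains_of_axialOn_of_reg8_of_suppPt (Stage13HParams.ofHistoryBlind F N ⟨theta13OfThm1CCMW F N j γ ε₀ ε₂₉ B₃ B₃' a₀ a₁, ZrOfRecord₁₃ F N (theta13OfThm1CCMW F N j γ ε₀ ε₂₉ B₃ B₃' a₀ a₁)⟩)
    (N24_provisos₁₃SepCoPH_door_theta13OfThm1CCMW_of_gauge9TopStepR_of_betaBoxSignFree_allTorus hγ₀ hγh hε hε' hB hB' ha₀ ha₁ h15 hc h9 hbox hbox' hl hβ') hC cd hreg8 hle9 hεreg haxDom haxbg hχregpt hint9 h07sol h07res h07uniq hε9 hεbg hε3 hε2 hε₀⟩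

/-- **★ N09's TYPE `h09T` OF THE SPLIT CLOSERS AT THE WITNESS, SUPPLIED BY dag-n09-w3's COVARIANT SMALL-FIELD-BOOKKEEPING DOOR** (`…N09AtSmallFieldBookkeeping.thm3Member_forall_stage13SepCoPH_atDomAlt_of_orbitRel`,
p598357, ONE application; `γ₉ := 1`).  Displayed = N09's located list VERBATIM at the witness: `hε9`, (181)ˢᵒˡ `hcov`, `hsolν`, `hχdom`, `hint9`, `hreg`, [B11] ×3 `h07sol h07res h07uniq`, `horb`.
CONDITIONAL; N09 NOT discharged; K1⁷ NOT closed. [cite: Balaban1987RG1, Thm 3 p.264, p.259, (0.19) p.255, (1.1)–(1.3) p.260, (2.1)–(2.3) p.265, (2.9)–(2.10) pp.266–267, Lemma 4 p.280; Balaban1985Variational, Thm 1 (6), (8)–(10) p.279 and (181) p.307; Balaban1985Averaging, Prop. 2 (53)–(54) p.26; Balaban1989LargeFieldII, Thm 1 p.355 (bookkeeping)] -/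
theorem N24_h09T_theta13OfThm1CCMW_of_n09AtDomAltOrbitRel {j c : ℕ} {γ ε₀ ε₂₉ B₃ B₃' a₀ a₁ : ℝ} (hγ₀ : 0 < γ) (hγh : γ ≤ 1 / 2)
    (hε : 0 < ε₀) (hε' : 0 < ε₂₉) (hB : 0 ≤ B₃) (hB' : 0 ≤ B₃') (ha₀ : 0 < a₀) (ha₁ : 0 < a₁)
    (h15 : VariationalThm1RegSepCoP7M F N B₃ a₀ a₁) (hc : c ≤ F.L ^ j)
    (h9 : Gauge9RegSepTopStepR F N (fun ν K Ω => suppDomOfRecord F ν K Ω) (F.L ^ j) c B₃ B₃' a₀ a₁)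
    {bl β' : ℝ} (hbox : BetaLowerH bl γ (betaOfRecord₁₃ F N (theta13OfThm1CCMW F N j γ ε₀ ε₂₉ B₃ B₃' a₀ a₁)))
    (hbox' : BetaUpperH β' γ (betaOfRecord₁₃ F N (theta13OfThm1CCMW F N j γ ε₀ ε₂₉ B₃ B₃' a₀ a₁))) (hl : -bl * γ ^ 2 ≤ 3) (hβ' : β' * γ ^ 2 ≤ 3 / 4)
    (hε9 : 0 < (theta13OfThm1CCMW F N j γ ε₀ ε₂₉ B₃ B₃' a₀ a₁).ε₂₉)
    (hcov : ∀ (P : B12.RunParams), ∀ j < P.K, ∀ (v : GaugeTransf (F.P P.K) (j + 1) (SU N)) (W : GaugeField (F.P P.K) (j + 1) (SU N)),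
      UkExists F N P.K (j + 1) (theta13OfThm1CCMW F N j γ ε₀ ε₂₉ B₃ B₃' a₀ a₁).ν.εreg W →
        critCfgOfRecord F N (theta13OfThm1CCMW F N j γ ε₀ ε₂₉ B₃ B₃' a₀ a₁).ν P.K j (gaugeAct v W) = gaugeAct (liftTransf v) (critCfgOfRecord F N (theta13OfThm1CCMW F N j γ ε₀ ε₂₉ B₃ B₃' a₀ a₁).ν P.K j W))
    (hsolν : ∀ (P : B12.RunParams), ∀ j < P.K, ∀ W ∈ domAltOfRecord F N (theta13OfThm1CCMW F N j γ ε₀ ε₂₉ B₃ B₃' a₀ a₁).ν P.K (j + 1), UkExists F N P.K (j + 1) (theta13OfThm1CCMW F N j γ ε₀ ε₂₉ B₃ B₃' a₀ a₁).ν.εreg W)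
    (hχdom : ∀ (P : B12.RunParams), ∀ j < P.K, ∀ U : GaugeField (F.P P.K) j (SU N), (avOfRecord F N P.K j).avg U ∈ domAltOfRecord F N (theta13OfThm1CCMW F N j γ ε₀ ε₂₉ B₃ B₃' a₀ a₁).ν P.K (j + 1) →
      U ∉ domAltOfRecord F N (theta13OfThm1CCMW F N j γ ε₀ ε₂₉ B₃ B₃' a₀ a₁).ν P.K j → chiβOfRecord₁₃ F N (theta13OfThm1CCMW F N j γ ε₀ ε₂₉ B₃ B₃' a₀ a₁) P.K (gOfRecord₁₃ F N (theta13OfThm1CCMW F N j γ ε₀ ε₂₉ B₃ B₃' a₀ a₁) P) j U = 0)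
    (hint9 : ∀ (P : B12.RunParams), ∀ j < P.K, Integrable (betaInputOfRecord F N (TβOfRecord₁₃ F N) (chiβOfRecord₁₃ F N (theta13OfThm1CCMW F N j γ ε₀ ε₂₉ B₃ B₃' a₀ a₁)) P.K
      (gOfRecord₁₃ F N (theta13OfThm1CCMW F N j γ ε₀ ε₂₉ B₃ B₃' a₀ a₁) P) j) (fieldMeasure (F.P P.K) j (SU N)))
    (hreg : ∀ (P : B12.RunParams), ∀ j < P.K, domAltOfRecord F N (theta13OfThm1CCMW F N j γ ε₀ ε₂₉ B₃ B₃' a₀ a₁).ν P.K (j + 1) ⊆ regSetOfRecord F N P.K j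
      (betaInputOfRecord F N (TβOfRecord₁₃ F N) (chiβOfRecord₁₃ F N (theta13OfThm1CCMW F N j γ ε₀ ε₂₉ B₃ B₃' a₀ a₁)) P.K (gOfRecord₁₃ F N (theta13OfThm1CCMW F N j γ ε₀ ε₂₉ B₃ B₃' a₀ a₁) P) j))
    (h07sol : ∀ (P : B12.RunParams) (k : ℕ), k ≤ P.K → ∀ V ∈ domAltOfRecord F N (theta13OfThm1CCMW F N j γ ε₀ ε₂₉ B₃ B₃' a₀ a₁).ν P.K k, UkExists F N P.K k (theta13OfThm1CCMW F N j γ ε₀ ε₂₉ B₃ B₃' a₀ a₁).εbg V ∧ UniqueUkOrbit F N P.K k (theta13OfThm1CCMW F N j γ ε₀ ε₂₉ B₃ B₃' a₀ a₁).εbg V)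
    (h07res : ∀ (P : B12.RunParams) (k : ℕ), k ≤ P.K → HRestrict F N (theta13OfThm1CCMW F N j γ ε₀ ε₂₉ B₃ B₃' a₀ a₁).εbg P.K k (domAltOfRecord F N (theta13OfThm1CCMW F N j γ ε₀ ε₂₉ B₃ B₃' a₀ a₁).ν P.K k))
    (h07uniq : ∀ (P : B12.RunParams) (k : ℕ), k ≤ P.K → ∀ V ∈ domAltOfRecord F N (theta13OfThm1CCMW F N j γ ε₀ ε₂₉ B₃ B₃' a₀ a₁).ν P.K k, ∀ j < k,
      UniqueUkOrbit F N P.K (j + 1) (theta13OfThm1CCMW F N j γ ε₀ ε₂₉ B₃ B₃' a₀ a₁).εbg (Averaging.iter (avOfRecord F N P.K) (j + 1) (Uk F N P.K k (theta13OfThm1CCMW F N j γ ε₀ ε₂₉ B₃ B₃' a₀ a₁).εbg V)))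
    (horb : ∀ (P : B12.RunParams) (k : ℕ), k ≤ P.K → ∀ V ∈ domAltOfRecord F N (theta13OfThm1CCMW F N j γ ε₀ ε₂₉ B₃ B₃' a₀ a₁).ν P.K k, ∀ j < k, OrbitRel (j + 1) (Uk F N P.K k (theta13OfThm1CCMW F N j γ ε₀ ε₂₉ B₃ B₃' a₀ a₁).εbg V)
      (Uk F N P.K (j + 1) (theta13OfThm1CCMW F N j γ ε₀ ε₂₉ B₃ B₃' a₀ a₁).ν.εreg (Averaging.iter (avOfRecord F N P.K) (j + 1) (Uk F N P.K k (theta13OfThm1CCMW F N j γ ε₀ ε₂₉ B₃ B₃' a₀ a₁).εbg V)))) :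
    ∃ γ₉ : ℝ, 0 < γ₉ ∧ ∀ w : WorldP, w.C = (datumOfRecord₁₃SepCoPH F N (Stage13HParams.ofHistoryBlind F N ⟨theta13OfThm1CCMW F N j γ ε₀ ε₂₉ B₃ B₃' a₀ a₁, ZrOfRecord₁₃ F N (theta13OfThm1CCMW F N j γ ε₀ ε₂₉ B₃ B₃' a₀ a₁)⟩) (N24_provisos₁₃SepCoPH_door_theta13OfThm1CCMW_of_gauge9TopStepR_of_betaBoxSignFree_allTorus hγ₀ hγh hε hε' hB hB' ha₀ ha₁ h15 hc h9 hbox hbox' hl hβ')).C →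
      w.γ ≤ γ₉ → ∀ P : B12.RunParams, (leavesP w P).smallCouplings → (leavesP w P).smallFieldInductive :=
  ⟨1, one_pos, fun _ hC _ => thm3Member_forall_stage13SepCoPH_atDomAlt_of_orbitRel (Stage13HParams.ofHistoryBlind F N ⟨theta13OfThm1CCMW F N j γ ε₀ ε₂₉ B₃ B₃' a₀ a₁, ZrOfRecord₁₃ F N (theta13OfThm1CCMW F N j γ ε₀ ε₂₉ B₃ B₃' a₀ a₁)⟩)
    (N24_provisos₁₃SepCoPH_door_theta13OfThm1CCMW_of_gauge9TopStepR_of_betaBoxSignFree_allTorus hγ₀ hγh hε hε' hB hB' ha₀ ha₁ h15 hc h9 hbox hbox' hl hβ') hC hε9 hcov hsolν hχdom hint9 hreg h07sol h07res h07uniq horb⟩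

/-! ## §3 (v1.1). The shorter TWO-RADII door: dag-n09-w3's `N09TwoRadiiDoorForall` (p604132) — `horb` and `hsolν` DERIVED from `h07res` + `h07uniq` + `hreg8` + `0 ≤ εreg ≤ εbg` -/

/-- **★ N09's TYPE `h09T` AT THE WITNESS, SUPPLIED BY dag-n09-w3's TWO-RADII DOOR OF RECORD** (`N09TwoRadiiDoorForall.thm3Member_forall_stage13SepCoPH_atDomAlt_of_thm1_of_reg8`, p604132, ONE
application; `γ₉ := 1`).  Displayed = the SHORTEST N09 list on the covariant road, VERBATIM at the witness: `hε9 : 0 < ε₂₉`, `hreg8`, `hle9 : εreg ≤ εbg` (= `a₀ ≤ 1` here), `hεreg`, (181)ˢᵒˡ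
`hcov`, the support clause `hχdom`, (I19) `hint9`, the regularity inclusion `hreg`, [B11] Thm 1 ×3 at `εbg` (`h07sol h07res h07uniq`) — NO orbit clause, NO solvability clause, NO set family, NO
nesting.  CONDITIONAL; N09 NOT discharged; K1⁷ NOT closed. [cite: Balaban1987RG1, Thm 3 p.264, p.259, (1.1)–(1.3) p.260, (2.1)–(2.3) p.265, (2.9)–(2.10) pp.266–267; Balaban1985Variational, Thm 1 (6), (8)–(10) p.279 and (181) p.307 (bookkeeping)] -/
theorem N24_h09T_theta13OfThm1CCMW_of_n09TwoRadiiDoor {j c : ℕ} {γ ε₀ ε₂₉ B₃ B₃' a₀ a₁ : ℝ} (hγ₀ : 0 < γ) (hγh : γ ≤ 1 / 2)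
    (hε : 0 < ε₀) (hε' : 0 < ε₂₉) (hB : 0 ≤ B₃) (hB' : 0 ≤ B₃') (ha₀ : 0 < a₀) (ha₁ : 0 < a₁)
    (h15 : VariationalThm1RegSepCoP7M F N B₃ a₀ a₁) (hc : c ≤ F.L ^ j)
    (h9 : Gauge9RegSepTopStepR F N (fun ν K Ω => suppDomOfRecord F ν K Ω) (F.L ^ j) c B₃ B₃' a₀ a₁)
    {bl β' : ℝ} (hbox : BetaLowerH bl γ (betaOfRecord₁₃ F N (theta13OfThm1CCMW F N j γ ε₀ ε₂₉ B₃ B₃' a₀ a₁)))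
    (hbox' : BetaUpperH β' γ (betaOfRecord₁₃ F N (theta13OfThm1CCMW F N j γ ε₀ ε₂₉ B₃ B₃' a₀ a₁))) (hl : -bl * γ ^ 2 ≤ 3) (hβ' : β' * γ ^ 2 ≤ 3 / 4)
    (hε9 : 0 < (theta13OfThm1CCMW F N j γ ε₀ ε₂₉ B₃ B₃' a₀ a₁).ε₂₉)
    (hreg8 : ∀ (P : B12.RunParams) (k : ℕ), k ≤ P.K → ∀ V ∈ domAltOfRecord F N (theta13OfThm1CCMW F N j γ ε₀ ε₂₉ B₃ B₃' a₀ a₁).ν P.K k, Uk F N P.K k (theta13OfThm1CCMW F N j γ ε₀ ε₂₉ B₃ B₃' a₀ a₁).εbg V ∈ bgReg F N P.K k (theta13OfThm1CCMW F N j γ ε₀ ε₂₉ B₃ B₃' a₀ a₁).ν.εreg)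
    (hle9 : (theta13OfThm1CCMW F N j γ ε₀ ε₂₉ B₃ B₃' a₀ a₁).ν.εreg ≤ (theta13OfThm1CCMW F N j γ ε₀ ε₂₉ B₃ B₃' a₀ a₁).εbg)
    (hεreg : 0 ≤ (theta13OfThm1CCMW F N j γ ε₀ ε₂₉ B₃ B₃' a₀ a₁).ν.εreg)
    (hcov : ∀ (P : B12.RunParams), ∀ j < P.K, ∀ (v : GaugeTransf (F.P P.K) (j + 1) (SU N)) (W : GaugeField (F.P P.K) (j + 1) (SU N)),
      UkExists F N P.K (j + 1) (theta13OfThm1CCMW F N j γ ε₀ ε₂₉ B₃ B₃' a₀ a₁).ν.εreg W →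
        critCfgOfRecord F N (theta13OfThm1CCMW F N j γ ε₀ ε₂₉ B₃ B₃' a₀ a₁).ν P.K j (gaugeAct v W) = gaugeAct (liftTransf v) (critCfgOfRecord F N (theta13OfThm1CCMW F N j γ ε₀ ε₂₉ B₃ B₃' a₀ a₁).ν P.K j W))
    (hχdom : ∀ (P : B12.RunParams), ∀ j < P.K, ∀ U : GaugeField (F.P P.K) j (SU N), (avOfRecord F N P.K j).avg U ∈ domAltOfRecord F N (theta13OfThm1CCMW F N j γ ε₀ ε₂₉ B₃ B₃' a₀ a₁).ν P.K (j + 1) →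
      U ∉ domAltOfRecord F N (theta13OfThm1CCMW F N j γ ε₀ ε₂₉ B₃ B₃' a₀ a₁).ν P.K j → chiβOfRecord₁₃ F N (theta13OfThm1CCMW F N j γ ε₀ ε₂₉ B₃ B₃' a₀ a₁) P.K (gOfRecord₁₃ F N (theta13OfThm1CCMW F N j γ ε₀ ε₂₉ B₃ B₃' a₀ a₁) P) j U = 0)
    (hint9 : ∀ (P : B12.RunParams), ∀ j < P.K, Integrable (betaInputOfRecord F N (TβOfRecord₁₃ F N) (chiβOfRecord₁₃ F N (theta13OfThm1CCMW F N j γ ε₀ ε₂₉ B₃ B₃' a₀ a₁)) P.K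
      (gOfRecord₁₃ F N (theta13OfThm1CCMW F N j γ ε₀ ε₂₉ B₃ B₃' a₀ a₁) P) j) (fieldMeasure (F.P P.K) j (SU N)))
    (hreg : ∀ (P : B12.RunParams), ∀ j < P.K, domAltOfRecord F N (theta13OfThm1CCMW F N j γ ε₀ ε₂₉ B₃ B₃' a₀ a₁).ν P.K (j + 1) ⊆ regSetOfRecord F N P.K j
      (betaInputOfRecord F N (TβOfRecord₁₃ F N) (chiβOfRecord₁₃ F N (theta13OfThm1CCMW F N j γ ε₀ ε₂₉ B₃ B₃' a₀ a₁)) P.K (gOfRecord₁₃ F N (theta13OfThm1CCMW F N j γ ε₀ ε₂₉ B₃ B₃' a₀ a₁) P) j))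
    (h07sol : ∀ (P : B12.RunParams) (k : ℕ), k ≤ P.K → ∀ V ∈ domAltOfRecord F N (theta13OfThm1CCMW F N j γ ε₀ ε₂₉ B₃ B₃' a₀ a₁).ν P.K k, UkExists F N P.K k (theta13OfThm1CCMW F N j γ ε₀ ε₂₉ B₃ B₃' a₀ a₁).εbg V ∧ UniqueUkOrbit F N P.K k (theta13OfThm1CCMW F N j γ ε₀ ε₂₉ B₃ B₃' a₀ a₁).εbg V)
    (h07res : ∀ (P : B12.RunParams) (k : ℕ), k ≤ P.K → HRestrict F N (theta13OfThm1CCMW F N j γ ε₀ ε₂₉ B₃ B₃' a₀ a₁).εbg P.K k (domAltOfRecord F N (theta13OfThm1CCMW F N j γ ε₀ ε₂₉ B₃ B₃' a₀ a₁).ν P.K k))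
    (h07uniq : ∀ (P : B12.RunParams) (k : ℕ), k ≤ P.K → ∀ V ∈ domAltOfRecord F N (theta13OfThm1CCMW F N j γ ε₀ ε₂₉ B₃ B₃' a₀ a₁).ν P.K k, ∀ j < k,
      UniqueUkOrbit F N P.K (j + 1) (theta13OfThm1CCMW F N j γ ε₀ ε₂₉ B₃ B₃' a₀ a₁).εbg (Averaging.iter (avOfRecord F N P.K) (j + 1) (Uk F N P.K k (theta13OfThm1CCMW F N j γ ε₀ ε₂₉ B₃ B₃' a₀ a₁).εbg V))) :
    ∃ γ₉ : ℝ, 0 < γ₉ ∧ ∀ w : WorldP, w.C = (datumOfRecord₁₃SepCoPH F N (Stage13HParams.ofHistoryBlind F N ⟨theta13OfThm1CCMW F N j γ ε₀ ε₂₉ B₃ B₃' a₀ a₁, ZrOfRecord₁₃ F N (theta13OfThm1CCMW F N j γ ε₀ ε₂₉ B₃ B₃' a₀ a₁)⟩) (N24_provisos₁₃SepCoPH_door_theta13OfThm1CCMW_of_gauge9TopStepR_of_betaBoxSignFree_allTorus hγ₀ hγh hε hε' hB hB' ha₀ ha₁ h15 hc h9 hbox hbox' hl hβ')).C →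
      w.γ ≤ γ₉ → ∀ P : B12.RunParams, (leavesP w P).smallCouplings → (leavesP w P).smallFieldInductive :=
  ⟨1, one_pos, fun _ hC _ => Summit.QuantumFields.YangMills.BalabanUVNodes.N09TwoRadiiDoorForall.thm3Member_forall_stage13SepCoPH_atDomAlt_of_thm1_of_reg8 (Stage13HParams.ofHistoryBlind F N ⟨theta13OfThm1CCMW F N j γ ε₀ ε₂₉ B₃ B₃' a₀ a₁, ZrOfRecord₁₃ F N (theta13OfThm1CCMW F N j γ ε₀ ε₂₉ B₃ B₃' a₀ a₁)⟩)
    (N24_provisos₁₃SepCoPH_door_theta13OfThm1CCMW_of_gauge9TopStepR_of_betaBoxSignFree_allTorus hγ₀ hγh hε hε' hB hB' ha₀ ha₁ h15 hc h9 hbox hbox' hl hβ') hC hε9 hreg8 hle9 hεreg hcov hχdom hint9 hreg h07sol h07res h07uniq⟩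

end Summit.QuantumFields.YangMills.BalabanUVNodes.N24ChildrenSplitN09Suppliers

end
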